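import Literature.Topology.FourManifolds.LevelDiffeotopySuspension
import Literature.Topology.FourManifolds.ClosedBallProofs
import Literature.Topology.FourManifolds.RegularLevelSplitting
import Literature.Topology.FourManifolds.ImmersionOrientation
import Literature.Topology.FourManifolds.HandlebodyMirrorSymmetry
import HarnessLib

/-!
# Transport between levels: flow maps, level maps of ambient maps, connectedness, characters

Topic `Literature/Topology/FourManifolds` (fact seat
`provefact-Literature.Topology.FourManifolds.IsHandlebody.exists_diffeomorph_isBoundaryGluing_sphere`,
step F2b₁ of the Lickorish–Wallace DAG; level step H2 of the reduction of L1
`oneHandle_nonempty_diffeomorph`: the feet of the handle and their orientation characters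
(`HandleFeetOrientation.lean`) have to be carried from the level of the feet down to the seed
level along the flow, and across the seed diffeomorphism, before the two-disc theorem can be
applied there).  Everything here is **proved**; no named facts.

* `UnitSlab.levelFlowDiffeomorph` — in a unit-speed slab (`LevelFlowExtension.lean`) the flow
  for the time `ℓ₂ - ℓ₁` is a diffeomorphism of the level manifolds `∂{f ≤ ℓ₁} ≅ ∂{f ≤ ℓ₂}`
  (structures `sublevelAtlas`/`BoundaryManifold.chartedSpace`; the lift `levelLift` of
  `LevelEmbedding.lean`), Milnor 1965, Thm. 3.4;
* `levelDiffeomorphOfMaps` — a pair of mutually inverse maps of the ambient manifolds, smooth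
  near two levels which they exchange, induces a diffeomorphism of the level manifolds (used for
  the ambient reading of a level-preserving diffeomorphism of sublevel sets);
* `connectedSpace_level` — the level manifold is connected when the level set is;
* `det_mfderiv_comp_ne_zero`, and **transport of opposite orientation characters along a
  diffeomorphism of connected levels** (`isOrientationPreserving_comp_iff_of_diffeomorph`,
  `oppositeCharacters_comp`): if two disc maps `e₊, e₋` into `V₁` have opposite characters for
  every orientation of `V₁`, so do `Φ ∘ e₊, Φ ∘ e₋` for every orientation of `V₂`
  (pull the orientation back along `Φ`; Hirsch 1976, §4.4).

## References

* J. Milnor, *Lectures on the h-cobordism theorem* (1965), Thm. 3.4, proof of Thm. 3.13.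
  [MilnorHCobordism1965]
* M. W. Hirsch, *Differential Topology*, GTM 33 (1976), Ch. 4 §4, pp. 101–103. [HirschDT1976]
* J. M. Lee, *Introduction to Smooth Manifolds*, 2nd ed. (2013), Cor. 5.30, Prop. 15.5.
  [LeeSmoothManifolds2013]
-/

open scoped Manifold ContDiff Topology
open Set Function Filter Metric Module

noncomputable section

namespace Literature.Topology.FourManifolds

universe u

/-- Local notation: `𝔼 n` is the model Euclidean space `EuclideanSpace ℝ (Fin n)`. -/
local notation "𝔼 " n:arg => EuclideanSpace ℝ (Fin n)

/-! ### Jacobians of composites -/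

section Det

variable {E : Type*} [NormedAddCommGroup E] [NormedSpace ℝ E]
  {H₁ H₂ H₃ : Type*} [TopologicalSpace H₁] [TopologicalSpace H₂] [TopologicalSpace H₃]
  {I₁ : ModelWithCorners ℝ E H₁} {I₂ : ModelWithCorners ℝ E H₂} {I₃ : ModelWithCorners ℝ E H₃}
  {M₁ M₂ M₃ : Type*} [TopologicalSpace M₁] [ChartedSpace H₁ M₁] [TopologicalSpace M₂] [ChartedSpace H₂ M₂]
  [TopologicalSpace M₃] [ChartedSpace H₃ M₃]

/-- **The Jacobian of a composite of maps with invertible Jacobians is invertible** (chain rule,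
multiplicativity of the determinant). [folklore] -/
theorem det_mfderiv_comp_ne_zero {g : M₂ → M₃} {f : M₁ → M₂} (x : M₁)
    (hg : MDifferentiableAt I₂ I₃ g (f x)) (hf : MDifferentiableAt I₁ I₂ f x)
    (hg' : LinearMap.det (M := E) (mfderiv I₂ I₃ g (f x)).toLinearMap ≠ 0)
    (hf' : LinearMap.det (M := E) (mfderiv I₁ I₂ f x).toLinearMap ≠ 0) :
    LinearMap.det (M := E) (mfderiv I₁ I₃ (g ∘ f) x).toLinearMap ≠ 0 := by
  rw [mfderiv_comp x hg hf]
  have h1 := LinearMap.det_comp (M := E) (mfderiv I₂ I₃ g (f x)).toLinearMap (mfderiv I₁ I₂ f x).toLinearMap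
  have hprod : LinearMap.det (M := E) (mfderiv I₂ I₃ g (f x)).toLinearMap *
      LinearMap.det (M := E) (mfderiv I₁ I₂ f x).toLinearMap ≠ 0 := mul_ne_zero hg' hf'
  exact fun h0 => hprod (h1.symm.trans h0)

end Det

/-! ### Flow maps between the levels of a unit-speed slab -/

namespace UnitSlab

variable {n : ℕ} {M : Type u} [TopologicalSpace M] [ChartedSpace (EuclideanHalfSpace (n + 1)) M]
  [IsManifold (𝓡∂ (n + 1)) ∞ M] (S : UnitSlab (n := n) M) {ℓ₁ ℓ₂ : ℝ}
  {hint₁ : ∀ p, S.f p ≤ ℓ₁ → (𝓡∂ (n + 1)).IsInteriorPoint p}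
  {hreg₁ : ∀ p, S.f p = ℓ₁ → ¬ IsMCriticalPt (𝓡∂ (n + 1)) S.f p}
  {hint₂ : ∀ p, S.f p ≤ ℓ₂ → (𝓡∂ (n + 1)).IsInteriorPoint p}
  {hreg₂ : ∀ p, S.f p = ℓ₂ → ¬ IsMCriticalPt (𝓡∂ (n + 1)) S.f p}
  [cs₁ : ChartedSpace (EuclideanHalfSpace (n + 1)) ↥(S.f ⁻¹' Iic ℓ₁)]
  [cs₂ : ChartedSpace (EuclideanHalfSpace (n + 1)) ↥(S.f ⁻¹' Iic ℓ₂)]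
  (hcs₁ : cs₁ = (sublevelAtlas S.hf ℓ₁ hint₁ hreg₁).chartedSpace)
  (hcs₂ : cs₂ = (sublevelAtlas S.hf ℓ₂ hint₂ hreg₂).chartedSpace)
  (h₁ : ℓ₁ ∈ Ioo S.lo S.hi) (h₂ : ℓ₂ ∈ Ioo S.lo S.hi)

omit cs₂ in
include hcs₁ h₁ h₂ in
/-- Flowing a point of the level `ℓ₁` for the time `ℓ₂ - ℓ₁` lands on the level `ℓ₂`.
[cite: MilnorHCobordism1965, Thm. 3.4] -/
theorem apply_flow_levelIncl (v : S.Level ℓ₁) : S.f (S.θ (ℓ₂ - ℓ₁, S.levelIncl v)) = ℓ₂ := by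
  have hv : S.f (S.levelIncl v) = ℓ₁ := S.apply_coe hcs₁ v
  rw [S.apply_flow (by rw [hv]; exact h₁) (by rw [hv, show ℓ₁ + (ℓ₂ - ℓ₁) = ℓ₂ by ring]; exact h₂), hv]
  ring

/-- **The flow map between two levels of the slab.** [cite: MilnorHCobordism1965, Thm. 3.4] -/
def levelFlowMap (v : S.Level ℓ₁) : S.Level ℓ₂ :=
  levelLift hcs₂ (fun v : S.Level ℓ₁ => S.θ (ℓ₂ - ℓ₁, S.levelIncl v)) (S.apply_flow_levelIncl hcs₁ h₁ h₂) v

/-- The flow map on points of `M`. [folklore] -/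
@[simp] theorem levelIncl_levelFlowMap (v : S.Level ℓ₁) :
    S.levelIncl (S.levelFlowMap hcs₁ hcs₂ h₁ h₂ v) = S.θ (ℓ₂ - ℓ₁, S.levelIncl v) := rfl

variable [mfd₁ : IsManifold (𝓡∂ (n + 1)) ∞ ↥(S.f ⁻¹' Iic ℓ₁)] [mfd₂ : IsManifold (𝓡∂ (n + 1)) ∞ ↥(S.f ⁻¹' Iic ℓ₂)]

/-- The flow map is smooth. [cite: LeeSmoothManifolds2013, Cor. 5.30] -/
theorem contMDiff_levelFlowMap (hn : 1 ≤ n) : ContMDiff (𝓡 n) (𝓡 n) ∞ (S.levelFlowMap hcs₁ hcs₂ h₁ h₂) := fun v =>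
  contMDiffAt_levelLift hcs₂ (S.apply_flow_levelIncl hcs₁ h₁ h₂)
    (S.flow.contMDiff.contMDiffAt.comp v (contMDiffAt_const.prodMk (S.contMDiff_levelIncl hcs₁ hn v)))

/-- **The flow diffeomorphism between two levels of a unit-speed slab** `∂{f ≤ ℓ₁} ≅ ∂{f ≤ ℓ₂}`.
[cite: MilnorHCobordism1965, Thm. 3.4] -/
def levelFlowDiffeomorph (hn : 1 ≤ n) : S.Level ℓ₁ ≃ₘ⟮𝓡 n, 𝓡 n⟯ S.Level ℓ₂ where
  toFun := S.levelFlowMap hcs₁ hcs₂ h₁ h₂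
  invFun := S.levelFlowMap hcs₂ hcs₁ h₂ h₁
  left_inv v := by
    apply Subtype.ext; apply Subtype.ext
    show S.θ (ℓ₁ - ℓ₂, S.θ (ℓ₂ - ℓ₁, S.levelIncl v)) = S.levelIncl v
    rw [S.isFlowOf.map_add, show ℓ₁ - ℓ₂ + (ℓ₂ - ℓ₁) = 0 by ring, S.isFlowOf.map_zero]
  right_inv v := by
    apply Subtype.ext; apply Subtype.ext
    show S.θ (ℓ₂ - ℓ₁, S.θ (ℓ₁ - ℓ₂, S.levelIncl v)) = S.levelIncl v
    rw [S.isFlowOf.map_add, show ℓ₂ - ℓ₁ + (ℓ₁ - ℓ₂) = 0 by ring, S.isFlowOf.map_zero]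
  contMDiff_toFun := S.contMDiff_levelFlowMap hcs₁ hcs₂ h₁ h₂ hn
  contMDiff_invFun := S.contMDiff_levelFlowMap hcs₂ hcs₁ h₂ h₁ hn

/-- The flow diffeomorphism on points of `M`. [folklore] -/
@[simp] theorem levelIncl_levelFlowDiffeomorph (hn : 1 ≤ n) (v : S.Level ℓ₁) :
    S.levelIncl (S.levelFlowDiffeomorph hcs₁ hcs₂ h₁ h₂ hn v) = S.θ (ℓ₂ - ℓ₁, S.levelIncl v) := rfl

end UnitSlab

/-! ### The level diffeomorphism of a pair of ambient maps exchanging two levels -/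

section OfMaps

variable {n : ℕ} {M : Type u} [TopologicalSpace M] [ChartedSpace (EuclideanHalfSpace (n + 1)) M]
  [IsManifold (𝓡∂ (n + 1)) ∞ M] {M' : Type u} [TopologicalSpace M'] [ChartedSpace (EuclideanHalfSpace (n + 1)) M']
  [IsManifold (𝓡∂ (n + 1)) ∞ M']
  (S : UnitSlab (n := n) M) (S' : UnitSlab (n := n) M') {ℓ ℓ' : ℝ}
  {hint : ∀ p, S.f p ≤ ℓ → (𝓡∂ (n + 1)).IsInteriorPoint p}
  {hreg : ∀ p, S.f p = ℓ → ¬ IsMCriticalPt (𝓡∂ (n + 1)) S.f p}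
  {hint' : ∀ p, S'.f p ≤ ℓ' → (𝓡∂ (n + 1)).IsInteriorPoint p}
  {hreg' : ∀ p, S'.f p = ℓ' → ¬ IsMCriticalPt (𝓡∂ (n + 1)) S'.f p}
  [cs : ChartedSpace (EuclideanHalfSpace (n + 1)) ↥(S.f ⁻¹' Iic ℓ)]
  [cs' : ChartedSpace (EuclideanHalfSpace (n + 1)) ↥(S'.f ⁻¹' Iic ℓ')]
  (hcs : cs = (sublevelAtlas S.hf ℓ hint hreg).chartedSpace)
  (hcs' : cs' = (sublevelAtlas S'.hf ℓ' hint' hreg').chartedSpace)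
  [mfd : IsManifold (𝓡∂ (n + 1)) ∞ ↥(S.f ⁻¹' Iic ℓ)] [mfd' : IsManifold (𝓡∂ (n + 1)) ∞ ↥(S'.f ⁻¹' Iic ℓ')]
  {g : M → M'} {g' : M' → M}
  (hlev : ∀ x, S.f x = ℓ → S'.f (g x) = ℓ') (hlev' : ∀ y, S'.f y = ℓ' → S.f (g' y) = ℓ)

/-- **The level map of an ambient map taking the level `ℓ` to the level `ℓ'`.** [folklore] -/
def levelMapOfMap (v : S.Level ℓ) : S'.Level ℓ' :=
  levelLift hcs' (fun v : S.Level ℓ => g (S.levelIncl v)) (fun v => hlev _ (S.apply_coe hcs v)) v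

omit mfd mfd' in
/-- The level map on points. [folklore] -/
@[simp] theorem levelIncl_levelMapOfMap (v : S.Level ℓ) :
    S'.levelIncl (levelMapOfMap S S' hcs hcs' hlev v) = g (S.levelIncl v) := rfl

/-- The level map is smooth when the ambient map is smooth at the points of the level.
[cite: LeeSmoothManifolds2013, Cor. 5.30] -/
theorem contMDiff_levelMapOfMap (hn : 1 ≤ n)
    (hg : ∀ x, S.f x = ℓ → ContMDiffAt (𝓡∂ (n + 1)) (𝓡∂ (n + 1)) ∞ g x) :
    ContMDiff (𝓡 n) (𝓡 n) ∞ (levelMapOfMap S S' hcs hcs' hlev) := fun v =>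
  contMDiffAt_levelLift hcs' (fun v => hlev _ (S.apply_coe hcs v))
    ((hg _ (S.apply_coe hcs v)).comp v (S.contMDiff_levelIncl hcs hn v))

/-- **The level diffeomorphism of a pair of mutually inverse ambient maps exchanging the
levels**, smooth at the points of the levels. [folklore] -/
def levelDiffeomorphOfMaps (hn : 1 ≤ n)
    (hg : ∀ x, S.f x = ℓ → ContMDiffAt (𝓡∂ (n + 1)) (𝓡∂ (n + 1)) ∞ g x)
    (hg' : ∀ y, S'.f y = ℓ' → ContMDiffAt (𝓡∂ (n + 1)) (𝓡∂ (n + 1)) ∞ g' y)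
    (hinv : ∀ x, S.f x = ℓ → g' (g x) = x) (hinv' : ∀ y, S'.f y = ℓ' → g (g' y) = y) :
    S.Level ℓ ≃ₘ⟮𝓡 n, 𝓡 n⟯ S'.Level ℓ' where
  toFun := levelMapOfMap S S' hcs hcs' hlev
  invFun := levelMapOfMap S' S hcs' hcs hlev'
  left_inv v := by
    apply Subtype.ext; apply Subtype.ext
    exact hinv _ (S.apply_coe hcs v)
  right_inv v := by
    apply Subtype.ext; apply Subtype.ext
    exact hinv' _ (S'.apply_coe hcs' v)
  contMDiff_toFun := contMDiff_levelMapOfMap S S' hcs hcs' hlev hn hg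
  contMDiff_invFun := contMDiff_levelMapOfMap S' S hcs' hcs hlev' hn hg'

/-- The level diffeomorphism on points. [folklore] -/
@[simp] theorem levelIncl_levelDiffeomorphOfMaps (hn : 1 ≤ n)
    (hg : ∀ x, S.f x = ℓ → ContMDiffAt (𝓡∂ (n + 1)) (𝓡∂ (n + 1)) ∞ g x)
    (hg' : ∀ y, S'.f y = ℓ' → ContMDiffAt (𝓡∂ (n + 1)) (𝓡∂ (n + 1)) ∞ g' y)
    (hinv : ∀ x, S.f x = ℓ → g' (g x) = x) (hinv' : ∀ y, S'.f y = ℓ' → g (g' y) = y) (v : S.Level ℓ) :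
    S'.levelIncl (levelDiffeomorphOfMaps S S' hcs hcs' hlev hlev' hn hg hg' hinv hinv' v) = g (S.levelIncl v) := rfl

end OfMaps

/-! ### Connectedness of the level manifold -/

section Connected

variable {n : ℕ} {M : Type u} [TopologicalSpace M] [ChartedSpace (EuclideanHalfSpace (n + 1)) M]
  [IsManifold (𝓡∂ (n + 1)) ∞ M] (S : UnitSlab (n := n) M) {ℓ : ℝ}
  {hint : ∀ p, S.f p ≤ ℓ → (𝓡∂ (n + 1)).IsInteriorPoint p}
  {hreg : ∀ p, S.f p = ℓ → ¬ IsMCriticalPt (𝓡∂ (n + 1)) S.f p}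
  [cs : ChartedSpace (EuclideanHalfSpace (n + 1)) ↥(S.f ⁻¹' Iic ℓ)]
  (hcs : cs = (sublevelAtlas S.hf ℓ hint hreg).chartedSpace)

include hcs in
/-- **The level manifold is connected when the level set is** (it is a continuous image of it).
[folklore] -/
theorem UnitSlab.connectedSpace_level (h : IsConnected (S.f ⁻¹' {ℓ})) : ConnectedSpace (S.Level ℓ) := by
  -- the level set maps continuously onto the level manifold
  set φ : ↥(S.f ⁻¹' {ℓ}) → S.Level ℓ := fun x => levelLift hcs (fun x : ↥(S.f ⁻¹' {ℓ}) => (x : M)) (fun x => x.2) x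
    with hφ
  have hφc : Continuous φ := by
    apply Continuous.subtype_mk
    exact Continuous.subtype_mk continuous_subtype_val _
  have hsurj : Surjective φ := by
    intro v
    refine ⟨⟨S.levelIncl v, S.apply_coe hcs v⟩, ?_⟩
    apply Subtype.ext; apply Subtype.ext; rfl
  haveI : ConnectedSpace ↥(S.f ⁻¹' {ℓ}) := isConnected_iff_connectedSpace.1 h
  rw [connectedSpace_iff_univ, ← hsurj.range_eq]
  exact isConnected_range hφc

end Connected

/-! ### Transport of orientation characters along a diffeomorphism of levels -/

section Orientation

variable {n : ℕ} {V₁ V₂ : Type*} [TopologicalSpace V₁] [ChartedSpace (𝔼 n) V₁] [IsManifold (𝓡 n) ∞ V₁]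
  [TopologicalSpace V₂] [ChartedSpace (𝔼 n) V₂] [IsManifold (𝓡 n) ∞ V₂]

/-- **Characters are read off after a diffeomorphism from the pulled-back orientation**:
`Φ ∘ e` preserves `(o₀, o₂)` iff `e` preserves `(o₀, Φ^* o₂)`. [cite: HirschDT1976, §4.4 p. 101] -/
theorem isOrientationPreserving_comp_iff_of_diffeomorph (Φ : V₁ ≃ₘ⟮𝓡 n, 𝓡 n⟯ V₂) (o₂ : SmoothOrientation (𝓡 n) V₂)
    {e : 𝔼 n → V₁} (he : MDifferentiable 𝓘(ℝ, 𝔼 n) (𝓡 n) e)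
    (hdet : ∀ w, LinearMap.det (M := 𝔼 n) (mfderiv 𝓘(ℝ, 𝔼 n) (𝓡 n) e w).toLinearMap ≠ 0)
    (o₀ : Orientation ℝ (𝔼 n) (Fin (finrank ℝ (𝔼 n)))) :
    IsOrientationPreserving (SmoothOrientation.modelSpace o₀) o₂ (Φ ∘ e) ↔
      IsOrientationPreserving (SmoothOrientation.modelSpace o₀)
        (o₂.comapOfDetNeZero Φ Φ.contMDiff (by simp) (Φ.det_mfderiv_ne_zero (by simp))) e := by
  have hn' : (∞ : ℕ∞ω) ≠ 0 := by simp
  have hΦ : IsOrientationPreserving (o₂.comapOfDetNeZero Φ Φ.contMDiff hn' (Φ.det_mfderiv_ne_zero hn')) o₂ Φ :=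
    SmoothOrientation.isOrientationPreserving_comapOfDetNeZero o₂ Φ Φ.contMDiff hn' _
  constructor
  · intro h
    exact IsOrientationPreserving.of_comp_left h hΦ (Φ.mdifferentiable hn') he (Φ.det_mfderiv_ne_zero hn') hdet
  · intro h
    exact IsOrientationPreserving.comp_holds hΦ h (Φ.mdifferentiable hn') he (Φ.det_mfderiv_ne_zero hn') hdet

/-- **Opposite characters are transported along a diffeomorphism of levels**: if `e₊` preserves
`(o₀, o)` iff `e₋` preserves `(-o₀, o)` for every orientation `o` of `V₁`, then the same holds for
`Φ ∘ e₊`, `Φ ∘ e₋` and every orientation of `V₂`. [cite: HirschDT1976, §4.4 pp. 101–103] -/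
theorem oppositeCharacters_comp (Φ : V₁ ≃ₘ⟮𝓡 n, 𝓡 n⟯ V₂) {ep em : 𝔼 n → V₁}
    (hep : MDifferentiable 𝓘(ℝ, 𝔼 n) (𝓡 n) ep) (hem : MDifferentiable 𝓘(ℝ, 𝔼 n) (𝓡 n) em)
    (hdetp : ∀ w, LinearMap.det (M := 𝔼 n) (mfderiv 𝓘(ℝ, 𝔼 n) (𝓡 n) ep w).toLinearMap ≠ 0)
    (hdetm : ∀ w, LinearMap.det (M := 𝔼 n) (mfderiv 𝓘(ℝ, 𝔼 n) (𝓡 n) em w).toLinearMap ≠ 0)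
    (hopp : ∀ (o : SmoothOrientation (𝓡 n) V₁) (o₀ : Orientation ℝ (𝔼 n) (Fin (finrank ℝ (𝔼 n)))),
      IsOrientationPreserving (SmoothOrientation.modelSpace o₀) o ep ↔
        IsOrientationPreserving (SmoothOrientation.modelSpace (-o₀)) o em)
    (o₂ : SmoothOrientation (𝓡 n) V₂) (o₀ : Orientation ℝ (𝔼 n) (Fin (finrank ℝ (𝔼 n)))) :
    IsOrientationPreserving (SmoothOrientation.modelSpace o₀) o₂ (Φ ∘ ep) ↔
      IsOrientationPreserving (SmoothOrientation.modelSpace (-o₀)) o₂ (Φ ∘ em) := by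
  rw [isOrientationPreserving_comp_iff_of_diffeomorph Φ o₂ hep hdetp,
    isOrientationPreserving_comp_iff_of_diffeomorph Φ o₂ hem hdetm]
  exact hopp _ o₀

/-- A smooth embedding of the model space followed by a diffeomorphism is a smooth embedding.
[folklore] -/
theorem isSmoothEmbedding_diffeomorph_comp (Φ : V₁ ≃ₘ⟮𝓡 n, 𝓡 n⟯ V₂) {e : 𝔼 n → V₁}
    (he : Manifold.IsSmoothEmbedding 𝓘(ℝ, 𝔼 n) (𝓡 n) ∞ e) : Manifold.IsSmoothEmbedding 𝓘(ℝ, 𝔼 n) (𝓡 n) ∞ (Φ ∘ e) :=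
  he.diffeomorph_comp Φ

omit [IsManifold (𝓡 n) ∞ V₁] [IsManifold (𝓡 n) ∞ V₂] in
/-- Invertible Jacobians are kept after a diffeomorphism. [folklore] -/
theorem det_mfderiv_diffeomorph_comp_ne_zero (Φ : V₁ ≃ₘ⟮𝓡 n, 𝓡 n⟯ V₂) {e : 𝔼 n → V₁}
    (he : MDifferentiable 𝓘(ℝ, 𝔼 n) (𝓡 n) e)
    (hdet : ∀ w, LinearMap.det (M := 𝔼 n) (mfderiv 𝓘(ℝ, 𝔼 n) (𝓡 n) e w).toLinearMap ≠ 0) (w : 𝔼 n) :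
    LinearMap.det (M := 𝔼 n) (mfderiv 𝓘(ℝ, 𝔼 n) (𝓡 n) (Φ ∘ e) w).toLinearMap ≠ 0 :=
  det_mfderiv_comp_ne_zero w (Φ.mdifferentiable (by simp) _) (he w) (Φ.det_mfderiv_ne_zero (by simp) _) (hdet w)

end Orientation

end Literature.Topology.FourManifolds
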